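import Literature.Geometry.Lorentzian.FinalEraPackage2
import HarnessLib

/-!
# Stub H_step `stub_stepData` — levels, step times and thresholds of a normalised final era
# (crux `DispersingCapture`, stmt-FinalStateConjecture-17643, line `registered`, skeleton r11; lead prover c6, 2026-08-17)

Route `DissipativeFinalMotions` of the summit `FinalStateConjecture`. Pure bookkeeping for the bridge
"package + (NDF) + (NL) ⇒ rest-frame settled data" (`Lines/registered-c6.md` §2): from the far-flatness clause (F3), the far
orientation (F₀), the converse localisation (X3), the clock clause (X4b), quantitative effacement (landed H_rad (i)), the hole
orientation (F), the no-lead clause (NL) and `Rᵢ → ∞`, choose levels `ρl m ↑ ∞`, strictly increasing step times `t m ↑ ∞`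
and hole-time thresholds `τ' m` such that everything the construction needs holds beyond them (see the statement).

References: Dafermos–Luk arXiv:1710.01722, Conjecture 1 (the picture); DHRT arXiv:2104.08222, §1.
-/

set_option linter.dupNamespace false

noncomputable section

open scoped Manifold ContDiff Topology
open Filter Set Function MeasureTheory Literature.Geometry.Lorentzian

namespace Summit.FinalStateConjecture.FinalStateConjecture.Theorems.DissipativeFinalMotions.DispersingCapture

/-- Bookkeeping helper: every real sequence `f` is dominated, together with `m ↦ m`, by a strictly increasing
sequence (take `t m := m + ∑_{k ≤ m} |f k|`). -/
private theorem stepData_exists_strictMono_ge (f : ℕ → ℝ) :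
    ∃ t : ℕ → ℝ, StrictMono t ∧ (∀ m, f m ≤ t m) ∧ ∀ m : ℕ, (m : ℝ) ≤ t m := by
  refine ⟨fun m : ℕ ↦ (m : ℝ) + ∑ k ∈ Finset.range (m + 1), |f k|, ?_, ?_, ?_⟩
  · refine strictMono_nat_of_lt_succ fun m ↦ ?_
    simp only [Finset.sum_range_succ]
    push_cast
    linarith [abs_nonneg (f (m + 1))]
  · intro m
    have h1 : |f m| ≤ ∑ k ∈ Finset.range (m + 1), |f k| :=
      Finset.single_le_sum (f := fun k ↦ |f k|) (fun k _ ↦ abs_nonneg (f k))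
        (Finset.mem_range.2 (Nat.lt_succ_self m))
    have h2 : f m ≤ |f m| := le_abs_self _
    have h3 : (0 : ℝ) ≤ m := Nat.cast_nonneg m
    simp only
    linarith
  · intro m
    have h1 : (0 : ℝ) ≤ ∑ k ∈ Finset.range (m + 1), |f k| :=
      Finset.sum_nonneg fun k _ ↦ abs_nonneg (f k)
    simp only
    linarith

/-- Bookkeeping helper: every real sequence `f` is dominated, together with a constant `c` and `m ↦ m + 1`, by a
monotone sequence (take `g m := |c| + (m + 1) + ∑_{k ≤ m} |f k|`). -/
private theorem stepData_exists_monotone_ge (f : ℕ → ℝ) (c : ℝ) :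
    ∃ g : ℕ → ℝ, Monotone g ∧ (∀ m, f m ≤ g m) ∧ (∀ m, c ≤ g m) ∧ ∀ m : ℕ, (m : ℝ) + 1 ≤ g m := by
  refine ⟨fun m : ℕ ↦ |c| + ((m : ℝ) + 1) + ∑ k ∈ Finset.range (m + 1), |f k|, ?_, ?_, ?_, ?_⟩
  · refine monotone_nat_of_le_succ fun m ↦ ?_
    simp only [Finset.sum_range_succ]
    push_cast
    linarith [abs_nonneg (f (m + 1))]
  · intro m
    have h1 : |f m| ≤ ∑ k ∈ Finset.range (m + 1), |f k| :=
      Finset.single_le_sum (f := fun k ↦ |f k|) (fun k _ ↦ abs_nonneg (f k))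
        (Finset.mem_range.2 (Nat.lt_succ_self m))
    have h2 : f m ≤ |f m| := le_abs_self _
    have h3 : (0 : ℝ) ≤ m := Nat.cast_nonneg m
    have h4 : 0 ≤ |c| := abs_nonneg c
    simp only
    linarith
  · intro m
    have h1 : (0 : ℝ) ≤ ∑ k ∈ Finset.range (m + 1), |f k| :=
      Finset.sum_nonneg fun k _ ↦ abs_nonneg (f k)
    have h3 : (0 : ℝ) ≤ m := Nat.cast_nonneg m
    have h4 : c ≤ |c| := le_abs_self c
    simp only
    linarith
  · intro m
    have h1 : (0 : ℝ) ≤ ∑ k ∈ Finset.range (m + 1), |f k| :=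
      Finset.sum_nonneg fun k _ ↦ abs_nonneg (f k)
    have h4 : 0 ≤ |c| := abs_nonneg c
    simp only
    linarith

/-- **H_step — step data.** Levels `ρl` (monotone, `≥ ρ₀`, `≥ m+1`), strictly increasing step times `t` (`≥ m`, `≥ |T|+1`,
`≥ (m+1)·ρl m`) and thresholds `τ' ≥ T` such that: (F3) holds at tolerance `1/(m+1)` beyond distance `ρl m` on flat slabs after
`t m`; (F₀) holds beyond `ρl m` after `t m`; BAND LOCALISATION — a flat point of time `> t m` within `ρl m` of `ξᵢ` is `Ψᵢ x` with
`τ' m < x⁰`, `r(x) ≤ C₂ρl m + C₁`; after `τ' m`: truncated deviation `≤ 1/20` out to `C₂ρl m + C₁`, `dΨᵢ(V)` future-directed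
there, no hole-clock lead at radius `≤ C₂ρl m + C₁`, and `C₂ρl m + C₁ ≤ Rᵢ`. Bookkeeping over DHRT arXiv:2104.08222, §1. -/
theorem stub_stepData : open scoped Manifold Topology in ∀ (X : Type) [TopologicalSpace X] [ChartedSpace (EuclideanSpace ℝ (Fin 3)) X] [IsManifold (𝓡 3) ((⊤ : ℕ∞) : WithTop ℕ∞) X] [T2Space X] [SecondCountableTopology X] [ConnectedSpace X], ∀ (D : Literature.Geometry.Lorentzian.InitialDataSet (𝓡 3) X) (𝒟 : Literature.Geometry.Lorentzian.VacuumCauchyDevelopment D) (N : ℕ) (M a : Fin N → ℝ) (T C₁ C₂ ρ₀ ϱ₀ : ℝ) (ξ : Fin N → ℝ → EuclideanSpace ℝ (Fin 3)) (U₀ : TopologicalSpace.Opens Literature.Geometry.Lorentzian.E4) (Ψ₀ : (Literature.Geometry.Lorentzian.Minkowski.backgroundOn U₀).domain → 𝒟.carrier) (Ψ : (i : Fin N) → (Literature.Geometry.Lorentzian.Kerr.background (M i) (a i)).domain → 𝒟.carrier) (R : Fin N → ℝ → ℝ),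
    (∀ ε : ℝ, 0 < ε → ∃ ϱ T' : ℝ, ∀ τ, T' ≤ τ → Literature.Geometry.Lorentzian.supCkENorm (Subtype.val '' {y : (Literature.Geometry.Lorentzian.Minkowski.backgroundOn U₀).domain | y.1 0 = τ ∧ ∀ i, ϱ ≤ ‖Literature.Geometry.Lorentzian.E4.spatial y.1 - ξ i τ‖}) 2 (𝒟.toSpacetime.deviationExtend (Literature.Geometry.Lorentzian.Minkowski.backgroundOn U₀) Ψ₀) ≤ ENNReal.ofReal ε) →
    (∀ᶠ τ in Filter.atTop, ∀ y ∈ (Literature.Geometry.Lorentzian.Minkowski.backgroundOn U₀).timeSlab τ, (∀ i, ϱ₀ ≤ ‖Literature.Geometry.Lorentzian.E4.spatial y.1 - ξ i τ‖) → 𝒟.toSpacetime.timeOrientation.IsFutureDirected (mfderiv 𝓘(ℝ, Literature.Geometry.Lorentzian.E4) (𝓡 4) Ψ₀ y (Literature.Geometry.Lorentzian.E4.basisVector 0))) →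
    (∀ i (R' : ℝ), ∃ T₃ : ℝ, ∀ y : (Literature.Geometry.Lorentzian.Minkowski.backgroundOn U₀).domain, T₃ < y.1 0 → ‖Literature.Geometry.Lorentzian.E4.spatial y.1 - ξ i (y.1 0)‖ ≤ R' → ∃ x : (Literature.Geometry.Lorentzian.Kerr.background (M i) (a i)).domain, Ψ i x = Ψ₀ y ∧ T < x.1 0 ∧ Literature.Geometry.Lorentzian.Kerr.radius (a i) x.1 ≤ C₂ * R' + C₁) →
    (∀ i (τ' R' : ℝ), ∃ t₀ : ℝ, Ψ₀ '' {y : (Literature.Geometry.Lorentzian.Minkowski.backgroundOn U₀).domain | t₀ < y.1 0} ∩ Ψ i '' {x : (Literature.Geometry.Lorentzian.Kerr.background (M i) (a i)).domain | x.1 0 ≤ τ' ∧ Literature.Geometry.Lorentzian.Kerr.radius (a i) x.1 ≤ R'} = ∅) →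
    (∀ i (L ε : ℝ), 0 < ε → ∃ T'' : ℝ, ∀ τ, T'' ≤ τ → 𝒟.toSpacetime.truncDeviationCk (Literature.Geometry.Lorentzian.Kerr.background (M i) (a i)) (Ψ i) 2 L τ ≤ ENNReal.ofReal ε) →
    (∀ i (ρ : ℝ), ∀ᶠ τ in Filter.atTop, ∀ x ∈ (Literature.Geometry.Lorentzian.Kerr.background (M i) (a i)).truncTimeSlab ρ τ, 𝒟.toSpacetime.timeOrientation.IsFutureDirected (mfderiv 𝓘(ℝ, Literature.Geometry.Lorentzian.E4) (𝓡 4) (Ψ i) x (Literature.Geometry.Lorentzian.Kerr.timeVector (M i) (a i) x.1))) →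
    (∀ i (R' : ℝ), ∃ T₄ : ℝ, ∀ (x : (Literature.Geometry.Lorentzian.Kerr.background (M i) (a i)).domain) (y : (Literature.Geometry.Lorentzian.Minkowski.backgroundOn U₀).domain), T₄ ≤ x.1 0 → Literature.Geometry.Lorentzian.Kerr.radius (a i) x.1 ≤ R' → Ψ i x = Ψ₀ y → x.1 0 ≤ y.1 0) →
    (∀ i, Filter.Tendsto (R i) Filter.atTop Filter.atTop) →
    ∃ (t : ℕ → ℝ) (ρl : ℕ → ℝ) (τ' : ℕ → ℝ),
      StrictMono t ∧ (∀ m : ℕ, (m : ℝ) ≤ t m) ∧ (∀ m : ℕ, |T| + 1 ≤ t m) ∧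
      Monotone ρl ∧ (∀ m : ℕ, ρ₀ ≤ ρl m) ∧ (∀ m : ℕ, (m : ℝ) + 1 ≤ ρl m) ∧ (∀ m : ℕ, ((m : ℝ) + 1) * ρl m ≤ t m) ∧
      (∀ (m : ℕ) (τ : ℝ), t m ≤ τ → Literature.Geometry.Lorentzian.supCkENorm (Subtype.val '' {y : (Literature.Geometry.Lorentzian.Minkowski.backgroundOn U₀).domain | y.1 0 = τ ∧ ∀ i, ρl m ≤ ‖Literature.Geometry.Lorentzian.E4.spatial y.1 - ξ i τ‖}) 2 (𝒟.toSpacetime.deviationExtend (Literature.Geometry.Lorentzian.Minkowski.backgroundOn U₀) Ψ₀) ≤ ENNReal.ofReal (1 / ((m : ℝ) + 1))) ∧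
      (∀ m τ, t m ≤ τ → ∀ y ∈ (Literature.Geometry.Lorentzian.Minkowski.backgroundOn U₀).timeSlab τ, (∀ i, ρl m ≤ ‖Literature.Geometry.Lorentzian.E4.spatial y.1 - ξ i τ‖) → 𝒟.toSpacetime.timeOrientation.IsFutureDirected (mfderiv 𝓘(ℝ, Literature.Geometry.Lorentzian.E4) (𝓡 4) Ψ₀ y (Literature.Geometry.Lorentzian.E4.basisVector 0))) ∧
      (∀ m i (y : (Literature.Geometry.Lorentzian.Minkowski.backgroundOn U₀).domain), t m < y.1 0 → ‖Literature.Geometry.Lorentzian.E4.spatial y.1 - ξ i (y.1 0)‖ ≤ ρl m → ∃ x : (Literature.Geometry.Lorentzian.Kerr.background (M i) (a i)).domain, Ψ i x = Ψ₀ y ∧ τ' m < x.1 0 ∧ Literature.Geometry.Lorentzian.Kerr.radius (a i) x.1 ≤ C₂ * ρl m + C₁) ∧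
      (∀ m : ℕ, T ≤ τ' m) ∧
      (∀ m i τ, τ' m ≤ τ → 𝒟.toSpacetime.truncDeviationCk (Literature.Geometry.Lorentzian.Kerr.background (M i) (a i)) (Ψ i) 2 (C₂ * ρl m + C₁) τ ≤ ENNReal.ofReal (1 / 20)) ∧
      (∀ m i τ, τ' m ≤ τ → ∀ x ∈ (Literature.Geometry.Lorentzian.Kerr.background (M i) (a i)).truncTimeSlab (C₂ * ρl m + C₁) τ, 𝒟.toSpacetime.timeOrientation.IsFutureDirected (mfderiv 𝓘(ℝ, Literature.Geometry.Lorentzian.E4) (𝓡 4) (Ψ i) x (Literature.Geometry.Lorentzian.Kerr.timeVector (M i) (a i) x.1))) ∧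
      (∀ m i (x : (Literature.Geometry.Lorentzian.Kerr.background (M i) (a i)).domain) (y : (Literature.Geometry.Lorentzian.Minkowski.backgroundOn U₀).domain), τ' m ≤ x.1 0 → Literature.Geometry.Lorentzian.Kerr.radius (a i) x.1 ≤ C₂ * ρl m + C₁ → Ψ i x = Ψ₀ y → x.1 0 ≤ y.1 0) ∧
      (∀ m i τ, τ' m ≤ τ → C₂ * ρl m + C₁ ≤ R i τ) := by
  intro X _ _ _ _ _ _ D 𝒟 N M a T C₁ C₂ ρ₀ ϱ₀ ξ U₀ Ψ₀ Ψ R hF3 hF0 hX3 hX4b hEFF hF hNL hR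
  -- (1) far-flatness radii / thresholds at tolerance `1/(m+1)`; the far-orientation threshold
  choose ϱF TF hTF using fun m : ℕ ↦ hF3 (1 / ((m : ℝ) + 1)) (by positivity)
  obtain ⟨τF, hτF⟩ := Filter.eventually_atTop.1 hF0
  -- (2) levels `ρl m ≥ ρ₀, ϱ₀, ϱF m, m + 1`, monotone
  obtain ⟨ρl, hρl_mono, hρl_F, hρl_c, hρl_m⟩ := stepData_exists_monotone_ge ϱF (max ρ₀ ϱ₀)
  have hρl_ρ₀ : ∀ m, ρ₀ ≤ ρl m := fun m ↦ (le_max_left _ _).trans (hρl_c m)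
  have hρl_ϱ₀ : ∀ m, ϱ₀ ≤ ρl m := fun m ↦ (le_max_right _ _).trans (hρl_c m)
  -- (3) per-hole thresholds at the radius `C₂ ρl m + C₁`
  choose T3 hT3 using fun (i : Fin N) (m : ℕ) ↦ hX3 i (ρl m)
  choose Tq hTq using fun (i : Fin N) (m : ℕ) ↦ hEFF i (C₂ * ρl m + C₁) (1 / 20) (by norm_num)
  choose TV hTV using fun (i : Fin N) (m : ℕ) ↦ Filter.eventually_atTop.1 (hF i (C₂ * ρl m + C₁))
  choose T4 hT4 using fun (i : Fin N) (m : ℕ) ↦ hNL i (C₂ * ρl m + C₁)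
  choose TR hTR using fun (i : Fin N) (m : ℕ) ↦
    Filter.eventually_atTop.1 (Filter.tendsto_atTop.1 (hR i) (C₂ * ρl m + C₁))
  -- (4) hole-time thresholds `τ' m ≥ T` dominating the four families over `i : Fin N`
  choose b hb using fun m : ℕ ↦
    Finite.exists_le fun i : Fin N ↦ max (max (Tq i m) (TV i m)) (max (T4 i m) (TR i m))
  obtain ⟨τ', hτ'T, hτ'q, hτ'V, hτ'4, hτ'R⟩ : ∃ τ' : ℕ → ℝ, (∀ m, T ≤ τ' m) ∧ (∀ i m, Tq i m ≤ τ' m) ∧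
      (∀ i m, TV i m ≤ τ' m) ∧ (∀ i m, T4 i m ≤ τ' m) ∧ ∀ i m, TR i m ≤ τ' m := by
    refine ⟨fun m ↦ max T (b m), fun m ↦ le_max_left _ _, fun i m ↦ ?_, fun i m ↦ ?_, fun i m ↦ ?_,
      fun i m ↦ ?_⟩
    · exact ((le_max_left _ _).trans (le_max_left _ _)).trans ((hb m i).trans (le_max_right _ _))
    · exact ((le_max_right _ _).trans (le_max_left _ _)).trans ((hb m i).trans (le_max_right _ _))
    · exact ((le_max_left _ _).trans (le_max_right _ _)).trans ((hb m i).trans (le_max_right _ _))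
    · exact ((le_max_right _ _).trans (le_max_right _ _)).trans ((hb m i).trans (le_max_right _ _))
  -- (5) clock thresholds from (X4b) at `(τ' m, C₂ ρl m + C₁)`
  choose t0 ht0 using fun (i : Fin N) (m : ℕ) ↦ hX4b i (τ' m) (C₂ * ρl m + C₁)
  -- (6) step times
  choose b' hb' using fun m : ℕ ↦ Finite.exists_le fun i : Fin N ↦ max (T3 i m) (t0 i m)
  obtain ⟨t, ht_mono, ht_f, ht_m⟩ := stepData_exists_strictMono_ge fun m : ℕ ↦
    max (max (max (|T| + 1) (((m : ℝ) + 1) * ρl m)) (max (TF m) τF)) (b' m)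
  have ht_T : ∀ m, |T| + 1 ≤ t m := fun m ↦
    le_trans (le_max_of_le_left <| le_max_of_le_left <| le_max_left _ _) (ht_f m)
  have ht_ρ : ∀ m : ℕ, ((m : ℝ) + 1) * ρl m ≤ t m := fun m ↦
    le_trans (le_max_of_le_left <| le_max_of_le_left <| le_max_right _ _) (ht_f m)
  have ht_F : ∀ m, TF m ≤ t m := fun m ↦
    le_trans (le_max_of_le_left <| le_max_of_le_right <| le_max_left _ _) (ht_f m)
  have ht_τF : ∀ m, τF ≤ t m := fun m ↦
    le_trans (le_max_of_le_left <| le_max_of_le_right <| le_max_right _ _) (ht_f m)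
  have ht_3 : ∀ i m, T3 i m ≤ t m := fun i m ↦
    le_trans (le_max_of_le_right <| (le_max_left _ _).trans (hb' m i)) (ht_f m)
  have ht_0 : ∀ i m, t0 i m ≤ t m := fun i m ↦
    le_trans (le_max_of_le_right <| (le_max_right _ _).trans (hb' m i)) (ht_f m)
  refine ⟨t, ρl, τ', ht_mono, ht_m, ht_T, hρl_mono, hρl_ρ₀, hρl_m, ht_ρ, ?_, ?_, ?_, hτ'T, ?_, ?_, ?_, ?_⟩
  · -- (F3) at tolerance `1/(m+1)` beyond `ρl m ≥ ϱF m`, after `t m ≥ TF m` (monotonicity in the set)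
    intro m τ hτ
    have hsub : {y : (Literature.Geometry.Lorentzian.Minkowski.backgroundOn U₀).domain | y.1 0 = τ ∧
        ∀ i, ρl m ≤ ‖Literature.Geometry.Lorentzian.E4.spatial y.1 - ξ i τ‖} ⊆
        {y | y.1 0 = τ ∧ ∀ i, ϱF m ≤ ‖Literature.Geometry.Lorentzian.E4.spatial y.1 - ξ i τ‖} :=
      fun y hy ↦ ⟨hy.1, fun i ↦ (hρl_F m).trans (hy.2 i)⟩
    exact (supCkENorm_mono (Set.image_mono hsub) _ _).trans (hTF m τ ((ht_F m).trans hτ))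
  · -- (F₀) beyond `ρl m ≥ ϱ₀`, after `t m ≥ τF`
    intro m τ hτ y hy hfar
    exact hτF τ ((ht_τF m).trans hτ) y hy fun i ↦ (hρl_ϱ₀ m).trans (hfar i)
  · -- band localisation: (X3) after `t m ≥ T3 i m`, then `τ' m < x⁰` from the clock clause (X4b)
    intro m i y hty hdist
    obtain ⟨x, hxy, -, hrad⟩ := hT3 i m y ((ht_3 i m).trans_lt hty) hdist
    refine ⟨x, hxy, ?_, hrad⟩
    by_contra hle
    exact Set.eq_empty_iff_forall_notMem.1 (ht0 i m) (Ψ₀ y)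
      (Set.mem_inter (Set.mem_image_of_mem Ψ₀ ((ht_0 i m).trans_lt hty)) ⟨x, ⟨not_lt.1 hle, hrad⟩, hxy⟩)
  · -- truncated deviation `≤ 1/20` after `τ' m ≥ Tq i m`
    intro m i τ hτ
    exact hTq i m τ ((hτ'q i m).trans hτ)
  · -- hole orientation after `τ' m ≥ TV i m`
    intro m i τ hτ x hx
    exact hTV i m τ ((hτ'V i m).trans hτ) x hx
  · -- no hole-clock lead after `τ' m ≥ T4 i m`
    intro m i x y hx hrad hxy
    exact hT4 i m x y ((hτ'4 i m).trans hx) hrad hxy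
  · -- `C₂ ρl m + C₁ ≤ Rᵢ τ` after `τ' m ≥ TR i m`
    intro m i τ hτ
    exact hTR i m τ ((hτ'R i m).trans hτ)

end Summit.FinalStateConjecture.FinalStateConjecture.Theorems.DissipativeFinalMotions.DispersingCapture

end
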